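import Summits.NavierStokesRegularity.FluidComputer.GateBudgetSwingFloorBack
import Summits.NavierStokesRegularity.FluidComputer.GateBudgetSwingLock
import HarnessLib

/-!
# GateBudget part 111 — the swing transfer from below, III: the headline band floor (§296–§297)

Cell `pub-fluidc`, blueprint seat bp1 (gen 39, sixth item); namespace
`Summit.NavierStokesRegularity.FluidComputer.GateBudget`, headline family
`RotorKnob.rotorCircuit K K¹⁰ ε ρ` (modes `0 = a` carrier, `1 = b` clock, `2 = c` trigger,
`3 = d` transfer, `4 = ã` output) from `delayInit`, trigger primitive `C` (`C' = c`). Imports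
part 110 (`GateBudgetSwingFloorBack`: the band floor; through it parts 109, 102, 101, 99) and
part 103 (`GateBudgetSwingLock`: the numbers of the headline band radius; through it parts 100,
74, 14). HONEST FRAMING: a low prior, high value-of-information experiment on Tao's machine
paradigm; NOT a claim that NS blows up. Nothing here is about the Navier–Stokes equations.

THE POINT (SPEC-INPUT-bp1 §CG(3)(b); the necessity side of the swing law, third file — the
lower twin of part 103). Part 110 §294 priced a symmetric band swing FROM BELOW for ANY member
whose transfer mode is phase-locked from below, `A(sin²(Φ + φ₀) - E) ≤ d²`, inside an outer
ring `b² + c² ≤ R₁²` with an angle gap `|arccos(b/R₁) - arccos(b/R₂)| ≤ δ`. This file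
DISCHARGES those hypotheses for the headline member on the headline band of part 100, exactly
as part 103 discharged the upper ones. (§296) Part 14 §43's tracking law is two-sided, so part
74's `d² ≤ S² + 6L(T' - r)` has the twin `S² - 6L(T' - r) ≤ d²` (`S = sin Φ·a(r) + cos Φ·d(r)`,
`L = ε + ρ²e^{-K¹⁰} + Kã(T')`), and `S² ≥ a(r)² sin²Φ - |d(r)|` (`|a(r)| ≤ 1`,
`2|sin Φ cos Φ| ≤ 1`): the CRUDE LOCK FROM BELOW `a(r)²(sin²Φ - E) ≤ d(u)²` with the SAME
drift `E = (|d(r)| + d(r)² + 6L(T' - r))/a(r)²` as part 103 §282. (§297) On the kept ring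
`θ²ε² - ε²/10⁶ ≤ b² + c² ≤ θ²ε² + 2ε²/10⁶` the outer radius is `R₁ = √(θ²ε² + 2ε²/10⁶)`,
within `(13/10⁷)R₂` of part 103's `R₂ = √(θ²ε² - ε²/10⁶ - ε²/K¹⁰)`; with `|b| ≤ (31/32)θε` both
cosines `b/R₁`, `b/R₂` lie in `[-m, m]`, `m = (31/32)θε/R₂ ≤ (31/32)(1 + 2/10⁵)`, they differ
by `≤ (31/32)(13/10⁷)`, and part 110 §295 gives the ANGLE GAP `δ = 1/10⁵`
(`√(1 - m²) ≥ 0.2479`). Hence THE HEADLINE BAND FLOOR (`κ = 9999/10000` by part 99 §276,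
`η = κ/(1 + (2δ + (π/2)(κ⁻¹ - 1))/sin α₁)`):
`ã(t₂) - ã(t₁) ≥ (K·a(r)²·η/(ε⁻¹K¹⁰κR₂))·((cos²ψ₁ - sin²ψ₁ + cos²ψ₂ - sin²ψ₂)(cos α₁
- ((1 - κ)π/2 + δ)) - (|sin 2ψ₁| + |sin 2ψ₂|)(1 - sin α₁) + 2E₁(log sin(α₁/2) - log cos(α₁/2)))`
whenever `sin²ψ₁ + sin²ψ₂ ≤ 1`, with `α₁ = arccos m`, `ψ₁ = Φ₁ - α₁`,
`ψ₂ = -(α₁ + Φ₁ + ε⁻¹K¹⁰(C(t₂) - C(t₁)))`, `E₁ = E + π(κ⁻¹ - 1)` — the same data as part 103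
§283(b) — and `η ≥ 999/1000`, COEFFICIENT `≥ (999/1000)·a(r)²/(θK⁹)` (part 103:
`≤ (1 + 2/10⁴)·a(r)²/(θK⁹)` from above). NUMBERS (forecast, on part 104's windows
`|sin ψᵢ| ≤ 0.0075`, `cos α₁ ≥ 31/32`, `E₁ ≈ 3.2·10⁻⁴`): bracket `≥ 1.913`, so the floor is
`≈ 1.911·a(r)²/(θK⁹)` per band against part 104's ceiling `≈ 1.97·a(r)²/(θK⁹)`; with
`a(r)² ≥ 0.979`, `θ ≤ 29/20`: `≈ 1.29/K⁹` per band swing (part 71's crude floor: `1/K⁹`),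
necessity ceiling `≈ 0.110K⁹ + 1` after the re-count (part 72: `K⁹/7 + 1`).

* §296 `transfer_sq_ge_corot` (`S² - 6L(T' - r) ≤ d(u)²`); `corot_sq_ge_crude`
  (`a² sin²Φ - |d| ≤ S²` for `|a| ≤ 1`); `phase_lock_crude_ge` (headline member, `K, ε ≥ 0`,
  `0 ≤ r ≤ u ≤ T'`, `a(r) ≠ 0`): `a(r)²·(sin²((C(u) - C(r))/ρ²) - E) ≤ d(u)²`.
* §297 `headline_angle_gap` (`K ≥ 16`, `ε > 0`, `θ ≥ 5/4`, `|b| ≤ (31/32)θε`): `0 < R₁`,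
  `R₁² = θ²ε² + 2ε²/10⁶`, `|arccos(b/R₁) - arccos(b/R₂)| ≤ 1/10⁵`; `swing_band_headline_ge`
  (THE HEADLINE BAND FLOOR, displayed above, hypotheses of part 103 §283(b) plus
  `sin²ψ₁ + sin²ψ₂ ≤ 1`); `swing_coef_headline_ge` (`999/1000 ≤ η ≤ 1` and
  `(999/1000)·A/(θK⁹) ≤ K·A·η/(ε⁻¹K¹⁰κR₂)` for `A ≥ 0`).

HONEST LIMITS. (i) The FLOOR is still symbolic in `ψ₁, ψ₂, α₁, E`: the windows are part 104's
(`edge_angle_window`, `climb_phase_window`, `band_excess_window`) and the lower price on them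
(`≈ 1.911·a(r)²/(θK⁹)`) is the sequel, part 112; (ii) `k = 1` only; (iii) the re-count of
part 72 §219 with this floor is part 113 — until then `N ≤ K⁹/7 + 1` STANDS and
`≈ 0.110K⁹ + 1` is a FORECAST; (iv) nothing about Navier–Stokes.
[cite: Tao2016AveragedNS, §5.5 Theorem 5.3, (5.5), (b-eq), (c-eq), (d-eq), (ta-eq),
(energy-con)]
-/

noncomputable section

namespace Summit.NavierStokesRegularity.FluidComputer.GateBudget

open Real Set Filter Topology
open Literature.Analysis.FluidPDE.Tao2016AveragedNS

variable {K M ε ρ : ℝ} {X : ℝ → Fin 5 → ℝ} {C : ℝ → ℝ}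

/-! ## §296 The crude phase lock from below -/

/-- §296(a) The co-rotating bound of part 14 §43 from below: on `r ≤ u ≤ T'` (`r ≥ 0`),
`S(u)² - 6L(T' - r) ≤ d(u)²` with `S = sin Φ·a(r) + cos Φ·d(r)`, `Φ = (C(u) - C(r))/ρ²`,
`L = ε + ρ²e^{-K¹⁰} + Kã(T')` — the twin of part 74 `transfer_sq_le_corot`
(`|d - S| ≤ 2L(u - r)`, `|d + S| ≤ 3`). [derived: part 14 §43 `knob_phase_tracking_d`] -/
theorem transfer_sq_ge_corot
    (hX : ∀ t, HasDerivAt X (RotorKnob.rotorCircuit K (K ^ 10) ε ρ (X t)) t)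
    (h0 : X 0 = delayInit) (hC : ∀ t, HasDerivAt C (X t 2) t) (hK : 0 ≤ K) (hε : 0 ≤ ε)
    {r u T' : ℝ} (hr : 0 ≤ r) (hru : r ≤ u) (huT : u ≤ T') :
    (sin ((C u - C r) / ρ ^ 2) * X r 0 + cos ((C u - C r) / ρ ^ 2) * X r 3) ^ 2
      - 6 * (ε + ρ ^ 2 * exp (-K ^ 10) + K * X T' 4) * (T' - r) ≤ X u 3 ^ 2 := by
  obtain ⟨S, hS⟩ : ∃ S : ℝ, S = sin ((C u - C r) / ρ ^ 2) * X r 0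
    + cos ((C u - C r) / ρ ^ 2) * X r 3 := ⟨_, rfl⟩
  obtain ⟨L, hL⟩ : ∃ L : ℝ, L = ε + ρ ^ 2 * exp (-K ^ 10) + K * X T' 4 := ⟨_, rfl⟩
  rw [← hS, ← hL]
  have htr := knob_phase_tracking_d hX h0 hC hε hK hr hru
  rw [← hS] at htr
  have hL0 : 0 ≤ L := by
    rw [hL]; have := RotorKnob.e_nonneg hX h0 hK (hr.trans (hru.trans huT)); positivity
  have hmono : X u 4 ≤ X T' 4 := RotorKnob.rotorCircuit_output_monotone hK hX huT
  have hLu : ε + ρ ^ 2 * exp (-K ^ 10) + K * X u 4 ≤ L := by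
    rw [hL]; linarith only [mul_le_mul_of_nonneg_left hmono hK]
  have hdS : |X u 3 - S| ≤ 2 * (L * (T' - r)) := by
    refine htr.trans ?_
    have h1 : (ε + ρ ^ 2 * exp (-K ^ 10) + K * X u 4) * (u - r) ≤ L * (u - r) :=
      mul_le_mul_of_nonneg_right hLu (by linarith only [hru])
    have h2 : L * (u - r) ≤ L * (T' - r) := mul_le_mul_of_nonneg_left (by linarith) hL0
    linarith only [h1, h2]
  have hsum : |X u 3 + S| ≤ 3 := by
    have hd1 := RotorKnob.traj_abs_le_one hX h0 u 3
    have ha0 := RotorKnob.traj_abs_le_one hX h0 r 0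
    have hd0 := RotorKnob.traj_abs_le_one hX h0 r 3
    have hS2 : |S| ≤ 2 := by
      rw [hS]
      refine (abs_add_le _ _).trans ?_
      rw [abs_mul, abs_mul]
      have e1 : |sin ((C u - C r) / ρ ^ 2)| * |X r 0| ≤ 1 * 1 :=
        mul_le_mul (abs_sin_le_one _) ha0 (abs_nonneg _) zero_le_one
      have e2 : |cos ((C u - C r) / ρ ^ 2)| * |X r 3| ≤ 1 * 1 :=
        mul_le_mul (abs_cos_le_one _) hd0 (abs_nonneg _) zero_le_one
      linarith only [e1, e2]
    exact (abs_add_le _ _).trans (by linarith only [hd1, hS2])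
  have hprod : |(X u 3 - S) * (X u 3 + S)| ≤ 2 * (L * (T' - r)) * 3 := by
    rw [abs_mul]
    exact mul_le_mul hdS hsum (abs_nonneg _) (mul_nonneg zero_le_two (mul_nonneg hL0 (by linarith)))
  have hsq : X u 3 ^ 2 - S ^ 2 = (X u 3 - S) * (X u 3 + S) := by ring
  linarith only [hprod, neg_abs_le ((X u 3 - S) * (X u 3 + S)), hsq]

/-- §296(b) `a²·sin²Φ - |d| ≤ (sin Φ·a + cos Φ·d)²` for `|a| ≤ 1`
(`2 sin Φ cos Φ·a·d = sin 2Φ·a·d ≥ -|d|`, `cos²Φ·d² ≥ 0`) — the twin of part 103 §282(a).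
[derived: this file] -/
theorem corot_sq_ge_crude {a d φ : ℝ} (ha : |a| ≤ 1) :
    a ^ 2 * sin φ ^ 2 - |d| ≤ (sin φ * a + cos φ * d) ^ 2 := by
  have h2 : -|d| ≤ 2 * (sin φ * a) * (cos φ * d) := by
    have e : 2 * (sin φ * a) * (cos φ * d) = sin (2 * φ) * (a * d) := by
      rw [sin_two_mul]; ring
    rw [e]
    have h : |sin (2 * φ) * (a * d)| ≤ |d| := by
      calc |sin (2 * φ) * (a * d)| = |sin (2 * φ)| * (|a| * |d|) := by rw [abs_mul, abs_mul]
        _ ≤ 1 * (1 * |d|) :=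
            mul_le_mul (abs_sin_le_one _) (mul_le_mul_of_nonneg_right ha (abs_nonneg _))
              (by positivity) zero_le_one
        _ = |d| := by ring
    linarith only [h, neg_abs_le (sin (2 * φ) * (a * d))]
  have h3 : 0 ≤ cos φ ^ 2 * d ^ 2 := by positivity
  have e : (sin φ * a + cos φ * d) ^ 2
      = a ^ 2 * sin φ ^ 2 + 2 * (sin φ * a) * (cos φ * d) + cos φ ^ 2 * d ^ 2 := by ring
  rw [e]
  linarith only [h2, h3]

/-- §296(c) THE CRUDE PHASE LOCK FROM BELOW (headline member `M = K¹⁰`, `K, ε ≥ 0`,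
`0 ≤ r ≤ u ≤ T'`, `a(r) ≠ 0`): `a(r)²·(sin²((C(u) - C(r))/ρ²) - E) ≤ d(u)²` with part 103
§282(b)'s drift `E = (|d(r)| + d(r)² + 6(ε + ρ²e^{-K¹⁰} + Kã(T'))(T' - r))/a(r)²` — the
phase-locking hypothesis of parts 109/110 with `φ₀ = 0`, `A = a(r)²`.
[derived: this file §296(a)–(b)] -/
theorem phase_lock_crude_ge
    (hX : ∀ t, HasDerivAt X (RotorKnob.rotorCircuit K (K ^ 10) ε ρ (X t)) t)
    (h0 : X 0 = delayInit) (hC : ∀ t, HasDerivAt C (X t 2) t) (hK : 0 ≤ K) (hε : 0 ≤ ε)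
    {r u T' : ℝ} (hr : 0 ≤ r) (hru : r ≤ u) (huT : u ≤ T') (ha : X r 0 ≠ 0) :
    X r 0 ^ 2 * (sin ((C u - C r) / ρ ^ 2) ^ 2
      - (|X r 3| + X r 3 ^ 2 + 6 * (ε + ρ ^ 2 * exp (-K ^ 10) + K * X T' 4) * (T' - r))
        / X r 0 ^ 2) ≤ X u 3 ^ 2 := by
  have hcor := transfer_sq_ge_corot hX h0 hC hK hε hr hru huT
  have hS := corot_sq_ge_crude (φ := (C u - C r) / ρ ^ 2) (d := X r 3)
    (RotorKnob.traj_abs_le_one hX h0 r 0)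
  have ha2 : X r 0 ^ 2 ≠ 0 := pow_ne_zero 2 ha
  rw [mul_sub, mul_div_cancel₀ _ ha2]
  linarith only [hcor, hS, sq_nonneg (X r 3)]

/-! ## §297 The headline band floor -/

/-- §297(a) THE ANGLE GAP OF THE HEADLINE BAND (`K ≥ 16`, `ε > 0`, `θ ≥ 5/4`,
`R₁ = √(θ²ε² + 2ε²/10⁶)`, `R₂ = √(θ²ε² - ε²/10⁶ - ε²/K¹⁰)`, `|b| ≤ (31/32)θε`): `0 < R₁`,
`R₁² = θ²ε² + 2ε²/10⁶` and `|arccos(b/R₁) - arccos(b/R₂)| ≤ 1/10⁵` (`R₁ - R₂ ≤ (13/10⁷)R₂`;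
both cosines in `[-m, m]`, `m = (31/32)θε/R₂ ≤ (31/32)(1 + 2/10⁵)`, differing by
`≤ (31/32)(13/10⁷)`; `√(1 - m²) ≥ 0.2479`; part 110 §295).
[derived: part 103 §283(a), (c); part 110 §295 (numerics)] -/
theorem headline_angle_gap (hK : 16 ≤ K) (hε : 0 < ε) {θ R₁ R₂ b : ℝ} (hθ1 : 5 / 4 ≤ θ)
    (hR₁ : R₁ = √(θ ^ 2 * ε ^ 2 + 2 * ε ^ 2 / 10 ^ 6))
    (hR₂ : R₂ = √(θ ^ 2 * ε ^ 2 - ε ^ 2 / 10 ^ 6 - ε ^ 2 / K ^ 10))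
    (hb : |b| ≤ 31 / 32 * θ * ε) :
    0 < R₁ ∧ R₁ ^ 2 = θ ^ 2 * ε ^ 2 + 2 * ε ^ 2 / 10 ^ 6 ∧
      |arccos (b / R₁) - arccos (b / R₂)| ≤ 1 / 10 ^ 5 := by
  obtain ⟨hRpos, hRQ, hRlo2, -, -, hRhi⟩ := headline_band_radius hK hε hθ1 hR₂
  obtain ⟨-, hm1, hm2⟩ := swing_coef_headline (A := 0) hK hε hθ1 le_rfl hR₂
  have hθ0 : 0 < θ := by linarith
  have hθε : 0 < θ * ε := mul_pos hθ0 hε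
  have he2 : 0 < ε ^ 2 := by positivity
  have h1sq : R₁ ^ 2 = θ ^ 2 * ε ^ 2 + 2 * ε ^ 2 / 10 ^ 6 := by
    rw [hR₁, sq_sqrt (by positivity)]
  have hR10 : 0 ≤ R₁ := by rw [hR₁]; exact sqrt_nonneg _
  have hR1θ : θ * ε ≤ R₁ := by
    refine (abs_le_of_sq_le_sq' ?_ hR10).2
    rw [h1sq, mul_pow]; linarith only [he2]
  have hR1pos : 0 < R₁ := hθε.trans_le hR1θ
  have h21 : R₂ ≤ R₁ := hRhi.trans hR1θ
  -- the radius gap `R₁ - R₂ ≤ (13/10⁷)R₂`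
  have hK10 : ε ^ 2 / K ^ 10 ≤ ε ^ 2 / 10 ^ 6 := by
    have h : (16 : ℝ) ^ 10 ≤ K ^ 10 := pow_le_pow_left₀ (by norm_num) hK 10
    exact div_le_div_of_nonneg_left he2.le (by norm_num) (by nlinarith only [h])
  have hdiff : R₁ ^ 2 - R₂ ^ 2 ≤ 4 * ε ^ 2 / 10 ^ 6 := by rw [h1sq]; linarith only [hRQ, hK10]
  have hθe : 25 / 16 * ε ^ 2 ≤ (θ * ε) ^ 2 := by
    have hθsq : (5 / 4 : ℝ) ^ 2 ≤ θ ^ 2 := pow_le_pow_left₀ (by norm_num) hθ1 2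
    rw [mul_pow]; nlinarith only [hθsq, he2]
  have hgap : R₁ - R₂ ≤ 13 / 10 ^ 7 * R₂ := by
    have h1 : (R₁ - R₂) * R₂ ≤ 2 * ε ^ 2 / 10 ^ 6 := by
      nlinarith only [hdiff, sq_nonneg (R₁ - R₂)]
    have h2 : 2 * ε ^ 2 / 10 ^ 6 ≤ 13 / 10 ^ 7 * R₂ * R₂ := by nlinarith only [hRlo2, hθe]
    exact le_of_mul_le_mul_right (h1.trans h2) hRpos
  -- both cosines lie in `[-m, m]`, `m = (31/32)θε/R₂ < 1`
  have hm3 : 31 / 32 * θ * ε / R₂ < 1 := by linarith only [hm2]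
  have hy0 : |b| / R₂ ≤ 31 / 32 * θ * ε / R₂ := div_le_div_of_nonneg_right hb hRpos.le
  have hy : |b / R₂| ≤ 31 / 32 * θ * ε / R₂ := by rw [abs_div, abs_of_pos hRpos]; exact hy0
  have hx : |b / R₁| ≤ 31 / 32 * θ * ε / R₂ := by
    rw [abs_div, abs_of_pos hR1pos]
    exact (div_le_div_of_nonneg_left (abs_nonneg b) hRpos h21).trans hy0
  have hxy : |b / R₁ - b / R₂| ≤ 13 / 10 ^ 7 * (31 / 32) := by
    have e : b / R₁ - b / R₂ = -(b / (R₁ * R₂) * (R₁ - R₂)) := by field_simp; ring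
    rw [e, abs_neg, abs_mul, abs_div, abs_of_pos (mul_pos hR1pos hRpos),
      abs_of_nonneg (sub_nonneg.2 h21)]
    calc |b| / (R₁ * R₂) * (R₁ - R₂) ≤ |b| / (R₁ * R₂) * (13 / 10 ^ 7 * R₂) :=
          mul_le_mul_of_nonneg_left hgap (by positivity)
      _ = 13 / 10 ^ 7 * (|b| / R₁) := by field_simp
      _ ≤ 13 / 10 ^ 7 * (31 / 32) := by
          refine mul_le_mul_of_nonneg_left ?_ (by norm_num)
          rw [div_le_iff₀ hR1pos]; linarith only [hb, hR1θ]
  have hs : 2479 / 10000 ≤ √(1 - (31 / 32 * θ * ε / R₂) ^ 2) := by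
    calc (2479 / 10000 : ℝ) = √((2479 / 10000) ^ 2) := (sqrt_sq (by norm_num)).symm
      _ ≤ _ := sqrt_le_sqrt (by nlinarith only [hm1, hm2])
  refine ⟨hR1pos, h1sq, (abs_arccos_sub_arccos_le hm3 hx hy).trans ?_⟩
  rw [div_le_iff₀ (lt_of_lt_of_le (by norm_num) hs)]
  linarith only [hxy, hs]

/-- §297(b) THE HEADLINE BAND FLOOR (hypotheses of part 103 §283(b) `swing_band_headline`:
headline member `K ≥ 16`, `ε > 0`, UNIT LATTICE `ε = K¹⁰ρ²` (`k = 1`), `θ ≥ 5/4`; a pulse start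
`r ≥ 0` and an end `T'` with the kept ring `θ²ε² - ε²/10⁶ ≤ b² + c² ≤ θ²ε² + 2ε²/10⁶` and
`c > 0` on `[r, T']`, `a(r) ≠ 0`; a symmetric band `r ≤ t₁ ≤ t₂ ≤ T'`,
`b(t₁) = (31/32)θε = -b(t₂)`, `|b| ≤ (31/32)θε` on `[t₁, t₂]` — part 100 §277; abbreviations
`R₂`, `E`, `α₁`, `ψ₁`, `ψ₂`, `E₁` as there and `η = κ/(1 + (2/10⁵ + (π/2)(κ⁻¹ - 1))/sin α₁)`,
`κ = 9999/10000`; plus `sin²ψ₁ + sin²ψ₂ ≤ 1`):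
`(K·a(r)²·η/(ε⁻¹K¹⁰κR₂))·((cos²ψ₁ - sin²ψ₁ + cos²ψ₂ - sin²ψ₂)(cos α₁ - ((1 - κ)π/2 + 1/10⁵))
- (|sin 2ψ₁| + |sin 2ψ₂|)(1 - sin α₁) + 2E₁(log sin(α₁/2) - log cos(α₁/2))) ≤ ã(t₂) - ã(t₁)`.
[derived: part 99 §276; part 103 §283(a); part 110 §294; this file §296(c), §297(a)] -/
theorem swing_band_headline_ge
    (hX : ∀ t, HasDerivAt X (RotorKnob.rotorCircuit K (K ^ 10) ε ρ (X t)) t)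
    (h0 : X 0 = delayInit) (hC : ∀ t, HasDerivAt C (X t 2) t) (hK : 16 ≤ K) (hε : 0 < ε)
    (hlat : ε = K ^ 10 * ρ ^ 2) {r t₁ t₂ T' θ : ℝ} (hr : 0 ≤ r) (hrt : r ≤ t₁) (ht : t₁ ≤ t₂)
    (htT : t₂ ≤ T') (hθ1 : 5 / 4 ≤ θ) (ha : X r 0 ≠ 0)
    (hring : ∀ u ∈ Icc r T', θ ^ 2 * ε ^ 2 - ε ^ 2 / 10 ^ 6 ≤ X u 1 ^ 2 + X u 2 ^ 2 ∧
      X u 1 ^ 2 + X u 2 ^ 2 ≤ θ ^ 2 * ε ^ 2 + 2 * ε ^ 2 / 10 ^ 6)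
    (hpos : ∀ u ∈ Icc r T', 0 < X u 2) (hb1 : X t₁ 1 = 31 / 32 * θ * ε)
    (hb2 : X t₂ 1 = -(31 / 32 * θ * ε))
    (hband : ∀ u ∈ Icc t₁ t₂, -(31 / 32 * θ * ε) ≤ X u 1 ∧ X u 1 ≤ 31 / 32 * θ * ε)
    {R₂ E α₁ ψ₁ ψ₂ E₁ η : ℝ} (hR₂ : R₂ = √(θ ^ 2 * ε ^ 2 - ε ^ 2 / 10 ^ 6 - ε ^ 2 / K ^ 10))
    (hE : E = (|X r 3| + X r 3 ^ 2 + 6 * (ε + ρ ^ 2 * exp (-K ^ 10) + K * X T' 4) * (T' - r))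
      / X r 0 ^ 2)
    (hα₁ : α₁ = arccos (31 / 32 * θ * ε / R₂)) (hψ₁ : ψ₁ = (C t₁ - C r) / ρ ^ 2 - α₁)
    (hψ₂ : ψ₂ = -(α₁ + (C t₁ - C r) / ρ ^ 2 + ε⁻¹ * K ^ 10 * (C t₂ - C t₁)))
    (hE₁ : E₁ = E + π * ((9999 / 10000 : ℝ)⁻¹ - 1))
    (hη : η = 9999 / 10000
      / (1 + (2 * (1 / 10 ^ 5) + π / 2 * ((9999 / 10000 : ℝ)⁻¹ - 1)) / sin α₁))
    (hcψ : sin ψ₁ ^ 2 + sin ψ₂ ^ 2 ≤ 1) :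
    K * X r 0 ^ 2 * η / (ε⁻¹ * K ^ 10 * (9999 / 10000) * R₂) *
        ((cos ψ₁ ^ 2 - sin ψ₁ ^ 2 + (cos ψ₂ ^ 2 - sin ψ₂ ^ 2))
            * (cos α₁ - ((1 - 9999 / 10000) * (π / 2) + 1 / 10 ^ 5))
          - (|sin (2 * ψ₁)| + |sin (2 * ψ₂)|) * (1 - sin α₁)
          + 2 * E₁ * (log (sin (α₁ / 2)) - log (cos (α₁ / 2))))
      ≤ X t₂ 4 - X t₁ 4 := by
  have hK0 : (0 : ℝ) < K := by linarith
  have hM : (0 : ℝ) < K ^ 10 := by positivity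
  obtain ⟨hRpos, hRQ, hRlo2, hRband, -, -⟩ := headline_band_radius hK hε hθ1 hR₂
  have hlat1 : ε⁻¹ * K ^ 10 * ρ ^ 2 = 1 := by
    rw [mul_assoc, ← hlat]; exact inv_mul_cancel₀ hε.ne'
  have hrT : r ≤ T' := hrt.trans (ht.trans htT)
  have hsub : ∀ u ∈ Icc t₁ t₂, u ∈ Icc r T' := fun u hu => ⟨hrt.trans hu.1, hu.2.trans htT⟩
  -- the inner data, exactly as in part 103 §283(b)
  have hQ : R₂ ^ 2 + ε ^ 2 / K ^ 10 ≤ θ ^ 2 * ε ^ 2 - ε ^ 2 / 10 ^ 6 := hRQ.le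
  have hring2 : ∀ u ∈ Icc t₁ t₂, θ ^ 2 * ε ^ 2 - ε ^ 2 / 10 ^ 6 ≤ X u 1 ^ 2 + X u 2 ^ 2 :=
    fun u hu => (hring u (hsub u hu)).1
  have hbsq : ∀ u ∈ Icc t₁ t₂, X u 1 ^ 2 ≤ (31 / 32 * θ * ε) ^ 2 := by
    intro u hu
    obtain ⟨h1, h2⟩ := hband u hu
    exact sq_le_sq' h1 h2
  have hband2 : ∀ u ∈ Icc t₁ t₂, X u 1 ^ 2 < R₂ ^ 2 :=
    fun u hu => (hbsq u hu).trans_lt hRband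
  have hκ : ∀ u ∈ Icc t₁ t₂, 9999 / 10000 * X u 2 ≤ √(R₂ ^ 2 - X u 1 ^ 2) := by
    intro u hu
    have hup := (hring u (hsub u hu)).2
    refine band_kappa_headline hθ1 hε hRlo2 ?_ ?_
    · rw [← mul_pow, ← mul_assoc]; exact hbsq u hu
    · rw [mul_pow]; exact hup
  have hpos2 : ∀ u ∈ Icc t₁ t₂, 0 < X u 2 := fun u hu => hpos u (hsub u hu)
  have hsym : X t₂ 1 = -X t₁ 1 := by rw [hb1, hb2]
  -- the outer ring and the angle gap (§297(a))
  obtain ⟨R₁, hR₁⟩ : ∃ R₁ : ℝ, R₁ = √(θ ^ 2 * ε ^ 2 + 2 * ε ^ 2 / 10 ^ 6) := ⟨_, rfl⟩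
  have habs : ∀ u ∈ Icc t₁ t₂, |X u 1| ≤ 31 / 32 * θ * ε := fun u hu => abs_le.2 (hband u hu)
  obtain ⟨hR1pos, h1sq, -⟩ := headline_angle_gap hK hε hθ1 hR₁ hR₂ (habs t₁ ⟨le_rfl, ht⟩)
  have hring1 : ∀ u ∈ Icc t₁ t₂, X u 1 ^ 2 + X u 2 ^ 2 ≤ R₁ ^ 2 := by
    intro u hu
    rw [h1sq]; exact (hring u (hsub u hu)).2
  have hδ : ∀ u ∈ Icc t₁ t₂, |arccos (X u 1 / R₁) - arccos (X u 1 / R₂)| ≤ 1 / 10 ^ 5 :=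
    fun u hu => (headline_angle_gap hK hε hθ1 hR₁ hR₂ (habs u hu)).2.2
  -- the crude phase lock from below (§296) on the band
  have hd : ∀ u ∈ Icc t₁ t₂,
      X r 0 ^ 2 * (sin ((C u - C r) / ρ ^ 2 + 0) ^ 2 - E) ≤ X u 3 ^ 2 := by
    intro u hu
    rw [add_zero, hE]
    exact phase_lock_crude_ge hX h0 hC hK0.le hε.le hr (hrt.trans hu.1) (hu.2.trans htT) ha
  have hE0 : 0 ≤ E := by
    rw [hE]
    have hT0 : 0 ≤ T' := hr.trans hrT
    have he := RotorKnob.e_nonneg hX h0 hK0.le hT0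
    have hτ : 0 ≤ T' - r := by linarith
    positivity
  have hα₁' : α₁ = arccos (X t₁ 1 / R₂) := by rw [hα₁, hb1]
  have hψ₁' : ψ₁ = (C t₁ - C r) / ρ ^ 2 + 0 - α₁ := by rw [hψ₁, add_zero]
  have hψ₂' : ψ₂ = -(α₁ + ((C t₁ - C r) / ρ ^ 2 + 0) + ε⁻¹ * K ^ 10 * (C t₂ - C t₁)) := by
    rw [hψ₂, add_zero]
  have hcψ' : 0 ≤ cos ψ₁ ^ 2 - sin ψ₁ ^ 2 + (cos ψ₂ ^ 2 - sin ψ₂ ^ 2) := by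
    linarith only [hcψ, sin_sq_add_cos_sq ψ₁, sin_sq_add_cos_sq ψ₂]
  exact swing_transfer_band_ge hX h0 hC hK0.le hε hM hlat1 ht hRpos hQ (by norm_num)
    (by norm_num) (sq_nonneg _) hE0 hring2 hband2 hκ hpos2 hsym hR1pos hring1 (by norm_num) hδ
    hd hα₁' hψ₁' hψ₂' hE₁ hη hcψ'

/-- §297(c) THE WINDOW FACTOR AND THE COEFFICIENT FROM BELOW (`K ≥ 16`, `ε > 0`, `θ ≥ 5/4`,
`R₂` as in part 103 §283(a), `α₁ = arccos((31/32)θε/R₂)`, `η` as in §297(b); no lattice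
needed): `999/1000 ≤ η ≤ 1` (`sin α₁ ≥ 0.2479`, `2/10⁵ + (π/2)/9999 ≤ 178/10⁶`) and
`(999/1000)·A/(θK⁹) ≤ K·A·η/(ε⁻¹K¹⁰(9999/10000)R₂)` for `A ≥ 0` (used with `A = a(r)²`;
part 103 §283(c): `≤ (1 + 2/10⁴)·A/(θK⁹)` without `η`).
[derived: part 103 §283(a), (c) (numerics); Mathlib `Real.pi_lt_d2`] -/
theorem swing_coef_headline_ge (hK : 16 ≤ K) (hε : 0 < ε) {θ R₂ A α₁ η : ℝ} (hθ1 : 5 / 4 ≤ θ)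
    (hA : 0 ≤ A) (hR₂ : R₂ = √(θ ^ 2 * ε ^ 2 - ε ^ 2 / 10 ^ 6 - ε ^ 2 / K ^ 10))
    (hα₁ : α₁ = arccos (31 / 32 * θ * ε / R₂))
    (hη : η = 9999 / 10000
      / (1 + (2 * (1 / 10 ^ 5) + π / 2 * ((9999 / 10000 : ℝ)⁻¹ - 1)) / sin α₁)) :
    999 / 1000 ≤ η ∧ η ≤ 1 ∧
      999 / 1000 * A / (θ * K ^ 9) ≤ K * A * η / (ε⁻¹ * K ^ 10 * (9999 / 10000) * R₂) := by
  have hK0 : (0 : ℝ) < K := by linarith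
  obtain ⟨hRpos, -, -, -, -, hRhi⟩ := headline_band_radius hK hε hθ1 hR₂
  obtain ⟨-, hm1, hm2⟩ := swing_coef_headline (A := 0) hK hε hθ1 le_rfl hR₂
  have hθ0 : 0 < θ := by linarith
  have hθε : 0 < θ * ε := mul_pos hθ0 hε
  -- `sin α₁ = √(1 - m²) ≥ 0.2479`
  have hs1 : 2479 / 10000 ≤ sin α₁ := by
    rw [hα₁, sin_arccos]
    calc (2479 / 10000 : ℝ) = √((2479 / 10000) ^ 2) := (sqrt_sq (by norm_num)).symm
      _ ≤ _ := sqrt_le_sqrt (by nlinarith only [hm1, hm2])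
  have hs0 : 0 < sin α₁ := lt_of_lt_of_le (by norm_num) hs1
  -- the window loss `ℓ = 2δ + (π/2)(κ⁻¹ - 1) ≤ 178/10⁶`, `ℓ/sin α₁ ≤ 7.2·10⁻⁴`
  have hk : ((9999 / 10000 : ℝ)⁻¹ - 1) = 1 / 9999 := by norm_num
  have hl0 : 0 ≤ 2 * (1 / 10 ^ 5) + π / 2 * ((9999 / 10000 : ℝ)⁻¹ - 1) := by
    rw [hk]; positivity
  have hl1 : 2 * (1 / 10 ^ 5) + π / 2 * ((9999 / 10000 : ℝ)⁻¹ - 1) ≤ 178 / 10 ^ 6 := by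
    rw [hk]; have := Real.pi_lt_d2; norm_num at this ⊢; linarith
  have hq : (2 * (1 / 10 ^ 5) + π / 2 * ((9999 / 10000 : ℝ)⁻¹ - 1)) / sin α₁
      ≤ 178 / 10 ^ 6 / (2479 / 10000) := div_le_div₀ (by norm_num) hl1 (by norm_num) hs1
  have hq0 : 0 ≤ (2 * (1 / 10 ^ 5) + π / 2 * ((9999 / 10000 : ℝ)⁻¹ - 1)) / sin α₁ :=
    div_nonneg hl0 hs0.le
  have hden : 0 < 1 + (2 * (1 / 10 ^ 5) + π / 2 * ((9999 / 10000 : ℝ)⁻¹ - 1)) / sin α₁ := by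
    linarith only [hq0]
  have hη9 : 999 / 1000 ≤ η := by
    rw [hη, le_div_iff₀ hden]; norm_num at hq ⊢; linarith only [hq]
  have hη1 : η ≤ 1 := by
    rw [hη, div_le_iff₀ hden]; linarith only [hq0]
  refine ⟨hη9, hη1, ?_⟩
  have e : K * A * η / (ε⁻¹ * K ^ 10 * (9999 / 10000) * R₂)
      = A * η * ε / ((9999 / 10000) * R₂ * K ^ 9) := by
    field_simp
  rw [e, div_le_div_iff₀ (by positivity) (by positivity)]
  have h1 : 999 / 1000 * A * ((9999 / 10000) * R₂ * K ^ 9)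
      = A * K ^ 9 * (999 / 1000 * (9999 / 10000) * R₂) := by ring
  have h2 : A * η * ε * (θ * K ^ 9) = A * K ^ 9 * (η * (θ * ε)) := by ring
  rw [h1, h2]
  refine mul_le_mul_of_nonneg_left ?_ (by positivity)
  nlinarith only [hRhi, hη9, hθε, hRpos]

end Summit.NavierStokesRegularity.FluidComputer.GateBudget
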